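import Summits.BirchSwinnertonDyer.BirchSwinnertonDyer.Theorems.KimAtThreeKwFrobenius
import Summits.BirchSwinnertonDyer.BirchSwinnertonDyer.Theorems.KimAtThreeFineKatoKPortEulerLatticeLocal
import HarnessLib

/-!
# K-PORT junction (J6): a FROBENIUS LIFT of an unramified completion `L_w` (Mathlib's norm) has order
# `f(w∣p)` with distinct lower powers — and the Euler-lattice index AT `K := K_w` from local data
# (cell `bsd-addord`, seat w2-kport gen 7; `--supports stmt-BirchSwinnertonDyer-19560`, helper)

HONEST FRAMING. Route W2 (`route-BirchSwinnertonDyer-KimAtThreeKolyvagin`), crux 19560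
`KatoKuriharaPortThreeShared`; the E-side LATTICE LEMMA of the good-ANOMALOUS rows (items 19679 / 19599,
support item 20397; w2-acc3 gen 7, «kernel modulo one transport (D3)», STATUS 2026-08-27 10:44:47Z).
The analytic half lives on `L_w = w.1.adicCompletion L` with Mathlib's norm and carries a ring endomorphism
`φ` with `hφ : ‖φ x‖ = ‖x‖`, `hφp : ‖x‖ ≤ 1 → ‖φ x − x^p‖ < 1` (a Frobenius lift) and `hdisc : ‖x‖ < 1 →
‖x‖ ≤ ‖p‖` (unramified); the algebraic half (`KimAtThreeEulerLatticeIndex.relIndex_integer_eulerLattice`,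
p521580) wants, in the port's `K_w = KPort.Kw p L w` currency, `[K_w : ℚ_p] = f`, `ψ^f = 1` and distinct lower
powers for the transported `ψ : K_w →ₐ[ℚ_[p]] K_w` (gen 6 `Kw.exists_algHom_of_forall_norm_eq`). This file
reads gen 7's abstract «Frobenius lift generates» file (`…KPortFrobeniusGenerator`) AT `K := K_w`:
with `f := f(w∣p) = w.1.asIdeal.inertiaDeg (𝓞 ℚ)` (`= [K_w : ℚ_p]` when `e(w∣p) = 1`,
`Kw.finrank_eq_inertiaDeg`), `φ^f = 1` pointwise and `φ^i ≠ φ^j` for `i ≠ j < f` — stated on `L_w` in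
Mathlib's own currency, no `K_w` in sight — and the Euler-lattice index at `K := K_w` for every `ψ` that is
`φ` pointwise, from (`hφ`, `hφp`, `hdisc`) alone; §4 then reads w2-acc3's lattice lemma (p527139 / p528906) with its
order/degree binders discharged. TOOL theorems only (no definition, no instance, no named
fact, no `sorry`); closes nothing by itself; nothing booked; BSD / 19560 are not proved by any of this.

## What is proved (`φ : L_w →+* L_w`; `hφ`, `hφp`, `hdisc` in Mathlib's norm; `f = w.1.asIdeal.inertiaDeg (𝓞 ℚ)`)

* §1 transport: `frobeniusLift_transport` (`ψ = φ` pointwise ⇒ `ψ` is a Frobenius lift for the base-`p`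
  norm), `hK_of_hdisc` (the port's `hK` on `K_w` from `hdisc`).
* §2 on `L_w`: **`ringHom_pow_inertiaDeg_apply_eq`** (`(φ ^ f) x = x`), **`eq_of_ringHom_pow_eq_pow`**
  (`i, j < f`, `⇑(φ^i) = ⇑(φ^j) ⇒ i = j`), `ringHom_eq_of_frobeniusLift` (uniqueness of the Frobenius lift).
* §3 on `K_w`: `algHom_pow_inertiaDeg_apply_eq` / `eq_of_algHom_pow_eq_pow` for any `ψ : K_w →ₐ[ℚ_[p]] K_w`
  with `ψ = φ` pointwise, and **`relIndex_integer_eulerLattice_completion`**: the Euler-lattice index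
  `[{y : (ψ² − aψ + q)y ∈ 𝒪_{K_w}} : 𝒪_{K_w}] = p^{v_p(q^f + 1 − D_f(a;q))}` from (`hφp`, `hdisc`).
* §4 THE LATTICE LEMMA WITH MINIMAL BINDERS (reading w2-acc3's `KimAtThreeEulerLatticeOfFrobenius` /
  `KimAtThreeKwFrobenius` through §1–§3): **`exists_padicLog_eq_iff_norm_eulerOperator_le_of_frobeniusLift`**
  — for `W/ℚ` globally minimal, `p ∤ Δ_min`, `e(w∣p) = 1`, ANY `φ : K_w →ₐ[ℚ_[p]] K_w` lifting `x ↦ x^p`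
  (`hφp`) and `E(L_w)[p] = 0`: `(∃ P, log_ω P = y) ↔ ‖φφy − a_p·φy + p·y‖ ≤ ‖p‖` (acc3's
  `exists_padicLog_eq_iff_norm_eulerOperator_le` with `hφ`/`hf0`/`hf`/`hfw`/`hpow`/`hdist` DISCHARGED);
  **`exists_padicLog_eq_iff_of_frobenius'`** — acc3's global-Frobenius form WITHOUT its `hord : ord σ = f(w∣p)`
  binder; and **`orderOf_eq_inertiaDeg_of_frobenius`** — that binder is a THEOREM: a Frobenius element
  `σ ∈ Aut(L/ℚ)` at an unramified `w` (`σ • w = w`, `σa ≡ a^p (mod w)`) has order exactly `f(w∣p)`.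

References: J.-P. Serre, *Local Fields* (1979), Ch. I §7–§8, Ch. II §1, Ch. III §5 [SerreLocalFields1979];
w2-acc3 HOME/w2acc3-g7/NOTES.md ## HANDOFF (D3 recipe).
-/

noncomputable section

-- the cell's Theorems namespace `Summit.BirchSwinnertonDyer.BirchSwinnertonDyer.…` repeats the summit name by design (D-0017)
set_option linter.dupNamespace false

open scoped Classical NNReal NormedField NumberField Pointwise
open IsDedekindDomain NumberField WithZeroMulInt Polynomial

namespace Summit.BirchSwinnertonDyer.BirchSwinnertonDyer.Theorems.KPort.Kw

variable {p : ℕ} [hp : Fact p.Prime] {L : Type} [Field L] [NumberField L]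
  {w : ((Rat.HeightOneSpectrum.primesEquiv (R := 𝓞 ℚ)).symm ⟨p, hp.out⟩).Extension (𝓞 L)}

/-! ## §1 Transport of the Frobenius-lift condition and of `hK` to the base-`p` norm of `K_w` -/

/-- The port's unramifiedness binder `hK` on `K_w` from the Mathlib-norm binder `hdisc` on `L_w`.
[cite: SerreLocalFields1979, Ch. II §1] -/
theorem hK_of_hdisc
    (hdisc : ∀ x : w.1.adicCompletion L, ‖x‖ < 1 → ‖x‖ ≤ ‖((p : ℕ) : w.1.adicCompletion L)‖)
    (x : Kw p L w) (hx : ‖x‖ < 1) : ‖x‖ ≤ ‖((p : ℕ) : Kw p L w)‖ :=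
  norm_le_norm_prime_of_norm_lt_one
    ((ramificationIdx_eq_one_iff_forall_norm_completion_lt_one (p := p) (L := L) (w := w)).mpr hdisc) x hx

/-- **Transport of the Frobenius-lift condition**: if `ψ : K_w → K_w` is `φ` pointwise and `φ` lifts the
`p`-power map for Mathlib's norm on `L_w`, then `ψ` lifts it for the base-`p` norm on `K_w` (same unit ball,
same maximal ideal). [cite: SerreLocalFields1979, Ch. II §1] -/
theorem frobeniusLift_transport {φ : w.1.adicCompletion L →+* w.1.adicCompletion L}
    (hφp : ∀ x : w.1.adicCompletion L, ‖x‖ ≤ 1 → ‖φ x - x ^ p‖ < 1)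
    {ψ : Kw p L w →ₐ[ℚ_[p]] Kw p L w} (hψ : ∀ x, toCompletion p L w (ψ x) = φ (toCompletion p L w x))
    (x : Kw p L w) (hx : ‖x‖ ≤ 1) : ‖ψ x - x ^ p‖ < 1 := by
  rw [← norm_toCompletion_lt_one_iff, map_sub, map_pow, hψ]
  exact hφp _ ((norm_toCompletion_le_one_iff x).mpr hx)

/-! ## §2 On `L_w` (Mathlib's currency): `φ^{f(w∣p)} = 1`, distinct lower powers, uniqueness -/

/-- **`φ ^ f(w∣p) = 1`** (pointwise) for an isometric Frobenius lift `φ` of an unramified completion `L_w`.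
[cite: SerreLocalFields1979, Ch. III §5] -/
theorem ringHom_pow_inertiaDeg_apply_eq (φ : w.1.adicCompletion L →+* w.1.adicCompletion L)
    (hφ : ∀ x, ‖φ x‖ = ‖x‖) (hφp : ∀ x : w.1.adicCompletion L, ‖x‖ ≤ 1 → ‖φ x - x ^ p‖ < 1)
    (hdisc : ∀ x : w.1.adicCompletion L, ‖x‖ < 1 → ‖x‖ ≤ ‖((p : ℕ) : w.1.adicCompletion L)‖)
    (x : w.1.adicCompletion L) : (φ ^ w.1.asIdeal.inertiaDeg (𝓞 ℚ)) x = x := by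
  have he := (ramificationIdx_eq_one_iff_forall_norm_completion_lt_one (p := p) (L := L) (w := w)).mpr hdisc
  haveI : Fact (w.1.asIdeal.ramificationIdx (𝓞 ℚ) = 1) := ⟨he⟩
  obtain ⟨ψ, hψ, -⟩ := exists_algHom_of_forall_norm_eq (p := p) (L := L) (w := w) φ hφ
  have h1 := pow_finrank_apply_eq_of_frobeniusLift (hK_of_hdisc hdisc) ψ (frobeniusLift_transport hφp hψ)
    ((toCompletion p L w).symm x)
  rw [finrank_eq_inertiaDeg (p := p) (L := L) (w := w) he] at h1
  have h2 := algHom_pow_apply_eq hψ (w.1.asIdeal.inertiaDeg (𝓞 ℚ)) ((toCompletion p L w).symm x)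
  rw [h1, RingEquiv.apply_symm_apply] at h2
  exact h2.symm

/-- **The powers `φ⁰, …, φ^{f−1}` are pairwise distinct** (as functions) for an isometric Frobenius lift `φ`
of an unramified completion `L_w`, `f = f(w∣p)`. [cite: SerreLocalFields1979, Ch. III §5] -/
theorem eq_of_ringHom_pow_eq_pow (φ : w.1.adicCompletion L →+* w.1.adicCompletion L)
    (hφ : ∀ x, ‖φ x‖ = ‖x‖) (hφp : ∀ x : w.1.adicCompletion L, ‖x‖ ≤ 1 → ‖φ x - x ^ p‖ < 1)
    (hdisc : ∀ x : w.1.adicCompletion L, ‖x‖ < 1 → ‖x‖ ≤ ‖((p : ℕ) : w.1.adicCompletion L)‖)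
    (i j : ℕ) (hi : i < w.1.asIdeal.inertiaDeg (𝓞 ℚ)) (hj : j < w.1.asIdeal.inertiaDeg (𝓞 ℚ))
    (h : (⇑(φ ^ i) : w.1.adicCompletion L → w.1.adicCompletion L) = ⇑(φ ^ j)) : i = j := by
  have he := (ramificationIdx_eq_one_iff_forall_norm_completion_lt_one (p := p) (L := L) (w := w)).mpr hdisc
  haveI : Fact (w.1.asIdeal.ramificationIdx (𝓞 ℚ) = 1) := ⟨he⟩
  obtain ⟨ψ, hψ, -⟩ := exists_algHom_of_forall_norm_eq (p := p) (L := L) (w := w) φ hφ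
  rw [← finrank_eq_inertiaDeg (p := p) (L := L) (w := w) he] at hi hj
  refine eq_of_pow_eq_pow_of_frobeniusLift (hK_of_hdisc hdisc) ψ (frobeniusLift_transport hφp hψ) i j hi hj ?_
  funext x
  apply (toCompletion p L w).injective
  rw [algHom_pow_apply_eq hψ i x, algHom_pow_apply_eq hψ j x, h]

/-- **Uniqueness of the Frobenius lift on `L_w`**: two isometric ring endomorphisms of an unramified
completion `L_w` lifting the `p`-power map of the residue field are equal.
[cite: SerreLocalFields1979, Ch. I §7–§8 and Ch. III §5] -/
theorem ringHom_eq_of_frobeniusLift (φ φ' : w.1.adicCompletion L →+* w.1.adicCompletion L)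
    (hφ : ∀ x, ‖φ x‖ = ‖x‖) (hφp : ∀ x : w.1.adicCompletion L, ‖x‖ ≤ 1 → ‖φ x - x ^ p‖ < 1)
    (hφ' : ∀ x, ‖φ' x‖ = ‖x‖) (hφ'p : ∀ x : w.1.adicCompletion L, ‖x‖ ≤ 1 → ‖φ' x - x ^ p‖ < 1)
    (hdisc : ∀ x : w.1.adicCompletion L, ‖x‖ < 1 → ‖x‖ ≤ ‖((p : ℕ) : w.1.adicCompletion L)‖) :
    φ = φ' := by
  have he := (ramificationIdx_eq_one_iff_forall_norm_completion_lt_one (p := p) (L := L) (w := w)).mpr hdisc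
  haveI : Fact (w.1.asIdeal.ramificationIdx (𝓞 ℚ) = 1) := ⟨he⟩
  obtain ⟨ψ, hψ, -⟩ := exists_algHom_of_forall_norm_eq (p := p) (L := L) (w := w) φ hφ
  obtain ⟨ψ', hψ', -⟩ := exists_algHom_of_forall_norm_eq (p := p) (L := L) (w := w) φ' hφ'
  have hψψ' := algHom_eq_of_frobeniusLift (hK_of_hdisc hdisc) ψ ψ' (frobeniusLift_transport hφp hψ)
    (frobeniusLift_transport hφ'p hψ')
  refine RingHom.ext fun x => ?_
  have h1 := hψ ((toCompletion p L w).symm x)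
  have h2 := hψ' ((toCompletion p L w).symm x)
  rw [RingEquiv.apply_symm_apply] at h1 h2
  rw [← h1, ← h2, hψψ']

/-! ## §3 On `K_w`: the transported `ψ`, and the Euler-lattice index at `K := K_w` from local data -/

/-- `ψ ^ f(w∣p) = 1` (pointwise) for any `ψ : K_w →ₐ[ℚ_[p]] K_w` that is `φ` pointwise.
[cite: SerreLocalFields1979, Ch. III §5] -/
theorem algHom_pow_inertiaDeg_apply_eq {φ : w.1.adicCompletion L →+* w.1.adicCompletion L}
    (hφp : ∀ x : w.1.adicCompletion L, ‖x‖ ≤ 1 → ‖φ x - x ^ p‖ < 1)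
    (hdisc : ∀ x : w.1.adicCompletion L, ‖x‖ < 1 → ‖x‖ ≤ ‖((p : ℕ) : w.1.adicCompletion L)‖)
    {ψ : Kw p L w →ₐ[ℚ_[p]] Kw p L w} (hψ : ∀ x, toCompletion p L w (ψ x) = φ (toCompletion p L w x))
    (x : Kw p L w) : (ψ ^ w.1.asIdeal.inertiaDeg (𝓞 ℚ)) x = x := by
  have he := (ramificationIdx_eq_one_iff_forall_norm_completion_lt_one (p := p) (L := L) (w := w)).mpr hdisc
  haveI : Fact (w.1.asIdeal.ramificationIdx (𝓞 ℚ) = 1) := ⟨he⟩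
  have h1 := pow_finrank_apply_eq_of_frobeniusLift (hK_of_hdisc hdisc) ψ (frobeniusLift_transport hφp hψ) x
  rwa [finrank_eq_inertiaDeg (p := p) (L := L) (w := w) he] at h1

/-- Distinct lower powers of any `ψ : K_w →ₐ[ℚ_[p]] K_w` that is `φ` pointwise, below `f(w∣p)`.
[cite: SerreLocalFields1979, Ch. III §5] -/
theorem eq_of_algHom_pow_eq_pow {φ : w.1.adicCompletion L →+* w.1.adicCompletion L}
    (hφp : ∀ x : w.1.adicCompletion L, ‖x‖ ≤ 1 → ‖φ x - x ^ p‖ < 1)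
    (hdisc : ∀ x : w.1.adicCompletion L, ‖x‖ < 1 → ‖x‖ ≤ ‖((p : ℕ) : w.1.adicCompletion L)‖)
    {ψ : Kw p L w →ₐ[ℚ_[p]] Kw p L w} (hψ : ∀ x, toCompletion p L w (ψ x) = φ (toCompletion p L w x))
    (i j : ℕ) (hi : i < w.1.asIdeal.inertiaDeg (𝓞 ℚ)) (hj : j < w.1.asIdeal.inertiaDeg (𝓞 ℚ))
    (h : (⇑(ψ ^ i) : Kw p L w → Kw p L w) = ⇑(ψ ^ j)) : i = j := by
  have he := (ramificationIdx_eq_one_iff_forall_norm_completion_lt_one (p := p) (L := L) (w := w)).mpr hdisc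
  haveI : Fact (w.1.asIdeal.ramificationIdx (𝓞 ℚ) = 1) := ⟨he⟩
  rw [← finrank_eq_inertiaDeg (p := p) (L := L) (w := w) he] at hi hj
  exact eq_of_pow_eq_pow_of_frobeniusLift (hK_of_hdisc hdisc) ψ (frobeniusLift_transport hφp hψ) i j hi hj h

/-- **The Euler-lattice index at `K := K_w` from local data.** For an unramified completion `L_w`
(`hdisc`), a ring endomorphism `φ` of `L_w` lifting the `p`-power map (`hφp`), any `ψ : K_w →ₐ[ℚ_[p]] K_w`
that is `φ` pointwise (gen 6 `Kw.exists_algHom_of_forall_norm_eq`), and `a, q ∈ ℤ` with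
`N = q^f + 1 − D_f(a;q) ≠ 0`, `f = f(w∣p)`: `[{y : (ψ² − aψ + q) y ∈ 𝒪_{K_w}} : 𝒪_{K_w}] = p^{v_p(N)}`
(acc3's `relIndex_integer_eulerLattice` with every binder discharged; `𝒪_{K_w}` is the NORM-valued integer
ring `@Valued.integer K_w _ ℝ≥0 _ NormedField.toValued`, spelled explicitly because `K_w` also carries its
`ℤᵐ⁰`-valued `Kw.instValued` — gen 6 `Kw.mem_integer_normedField_toValued_iff`: membership is `‖x‖ ≤ 1`).
[cite: SerreLocalFields1979, Ch. III §5] -/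
theorem relIndex_integer_eulerLattice_completion {φ : w.1.adicCompletion L →+* w.1.adicCompletion L}
    (hφp : ∀ x : w.1.adicCompletion L, ‖x‖ ≤ 1 → ‖φ x - x ^ p‖ < 1)
    (hdisc : ∀ x : w.1.adicCompletion L, ‖x‖ < 1 → ‖x‖ ≤ ‖((p : ℕ) : w.1.adicCompletion L)‖)
    {ψ : Kw p L w →ₐ[ℚ_[p]] Kw p L w} (hψ : ∀ x, toCompletion p L w (ψ x) = φ (toCompletion p L w x))
    (a q : ℤ) (hN : (q : ℤ_[p]) ^ w.1.asIdeal.inertiaDeg (𝓞 ℚ) + 1 -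
      (Polynomial.dickson 1 (q : ℤ_[p]) (w.1.asIdeal.inertiaDeg (𝓞 ℚ))).eval (a : ℤ_[p]) ≠ 0) :
    (@Valued.integer (Kw p L w) _ ℝ≥0 _ NormedField.toValued).toAddSubgroup.relIndex
        ((@Valued.integer (Kw p L w) _ ℝ≥0 _ NormedField.toValued).toAddSubgroup.comap
          (aeval (ψ : Kw p L w →ₗ[ℚ_[p]] Kw p L w)
            (X ^ 2 - C (a : ℚ_[p]) * X + C (q : ℚ_[p]))).toAddMonoidHom) =
      p ^ ((q : ℤ_[p]) ^ w.1.asIdeal.inertiaDeg (𝓞 ℚ) + 1 -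
        (Polynomial.dickson 1 (q : ℤ_[p]) (w.1.asIdeal.inertiaDeg (𝓞 ℚ))).eval (a : ℤ_[p])).valuation := by
  have he := (ramificationIdx_eq_one_iff_forall_norm_completion_lt_one (p := p) (L := L) (w := w)).mpr hdisc
  haveI : Fact (w.1.asIdeal.ramificationIdx (𝓞 ℚ) = 1) := ⟨he⟩
  haveI : IsUltrametricDist (Kw p L w) := isUltrametricDist (p := p) (L := L) (w := w)
  exact relIndex_integer_eulerLattice_of_frobeniusLift (hK_of_hdisc hdisc) ψ (frobeniusLift_transport hφp hψ)
    (finrank_eq_inertiaDeg (p := p) (L := L) (w := w) he) a q hN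

/-! ## §4 The lattice lemma `log_ω E(L_w) = E_p(φ)⁻¹𝒪_w` with minimal binders -/

section LatticeLemma

open Summit.BirchSwinnertonDyer.BirchSwinnertonDyer.Theorems.KimAtThreeEulerLatticeOfFrobenius
open Summit.BirchSwinnertonDyer.BirchSwinnertonDyer.Theorems.KimAtThreeKwFrobenius
open Literature.NumberTheory.Automorphic Literature.NumberTheory.AdelicBaseChange

variable (W : WeierstrassCurve ℚ) [W.IsElliptic] [W.IsGloballyMinimal]

/-- **The `⊇` half of the lattice lemma with minimal binders.** For `W/ℚ` globally minimal with
`p ∤ Δ_min(W)`, `w ∣ p` unramified (`e(w∣p) = 1`), ANY `ℚ_p`-algebra endomorphism `φ` of `K_w` lifting the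
`p`-power map (`hφp`) and `E(L_w)[p] = 0`: every `y ∈ K_w` with `‖φφy − a_p·φy + p·y‖ ≤ ‖p‖` is `log_ω P` for
some `P ∈ E(L_w)` — acc3's `exists_padicLog_eq_of_norm_eulerOperator_le` with the isometry, degree, order and
distinctness binders discharged by `…KPortFrobeniusGenerator` (`φ` generates `Gal(K_w/ℚ_p)`, `ord φ = f(w∣p)`).
[cite: BlochKato1990, Example 3.11] [cite: SilvermanAEC2009, Thm. IV.6.4 and V.2.3.1] -/
theorem exists_padicLog_eq_of_norm_eulerOperator_le_of_frobeniusLift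
    [he : Fact (w.1.asIdeal.ramificationIdx (𝓞 ℚ) = 1)]
    (hΔ : ¬ (p : ℤ) ∣ WeierstrassCurve.minimalDiscriminantInt W)
    (φ : Kw p L w →ₐ[ℚ_[p]] Kw p L w) (hφp : ∀ x : Kw p L w, ‖x‖ ≤ 1 → ‖φ x - x ^ p‖ < 1)
    (hT : ∀ P : (W.baseChange (w.1.adicCompletion L)).toAffine.Point, p • P = 0 → P = 0)
    {y : Kw p L w}
    (hy : ‖φ (φ y) - (W.frobeniusTrace p : Kw p L w) * φ y + (p : Kw p L w) * y‖ ≤ ‖(p : Kw p L w)‖) :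
    haveI := Literature.NumberTheory.EllipticCurves.EulerLattice.isIntegral_baseChange w.1 W
    ∃ P : (W.baseChange (w.1.adicCompletion L)).toAffine.Point,
      Literature.NumberTheory.EllipticCurves.FormalGroupChart.padicLogPointFiniteExt
        (NormedField.valuation : Valuation (w.1.adicCompletion L) ℝ≥0)
        (W.baseChange (w.1.adicCompletion L)) p P = toCompletion p L w y := by
  haveI : IsUltrametricDist (Kw p L w) := isUltrametricDist (p := p) (L := L) (w := w)
  have hK : ∀ x : Kw p L w, ‖x‖ < 1 → ‖x‖ ≤ ‖((p : ℕ) : Kw p L w)‖ :=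
    fun x hx => norm_le_norm_prime_of_norm_lt_one he.out x hx
  exact exists_padicLog_eq_of_norm_eulerOperator_le p L w W hΔ φ (norm_algHom_eq φ) hφp
    (finrank_pos p L w) rfl (finrank_eq_inertiaDeg p L w he.out).symm
    (pow_finrank_apply_eq_of_frobeniusLift hK φ hφp) (eq_of_pow_eq_pow_of_frobeniusLift hK φ hφp) hT hy

/-- **The lattice lemma `log_ω E(L_w) = E_p(φ)⁻¹𝒪_w` with minimal binders.** For `W/ℚ` globally minimal
with `p ∤ Δ_min(W)`, `w ∣ p` unramified (`e(w∣p) = 1`), ANY `ℚ_p`-algebra endomorphism `φ` of `K_w` lifting the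
`p`-power map of the residue field (`hφp`) and `E(L_w)[p] = 0`: `y ∈ K_w` is a formal-group logarithm
`log_ω P`, `P ∈ E(L_w)`, iff `‖φφy − a_p·φy + p·y‖ ≤ ‖p‖` — acc3's `exists_padicLog_eq_iff_norm_eulerOperator_le`
(p527139) with `hφ` (isometry), `hf0`/`hf`/`hfw` (degree) and `hpow`/`hdist` (order, distinct powers) ALL
DISCHARGED: such a `φ` is unique, isometric, and generates `Gal(K_w/ℚ_p)` of order `f(w∣p)`
(`…KPortFrobeniusGenerator`). [cite: BlochKato1990, Example 3.11] [cite: SilvermanAEC2009, Thm. IV.6.4 and V.2.3.1] -/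
theorem exists_padicLog_eq_iff_norm_eulerOperator_le_of_frobeniusLift
    [he : Fact (w.1.asIdeal.ramificationIdx (𝓞 ℚ) = 1)]
    (hΔ : ¬ (p : ℤ) ∣ WeierstrassCurve.minimalDiscriminantInt W)
    (φ : Kw p L w →ₐ[ℚ_[p]] Kw p L w) (hφp : ∀ x : Kw p L w, ‖x‖ ≤ 1 → ‖φ x - x ^ p‖ < 1)
    (hT : ∀ P : (W.baseChange (w.1.adicCompletion L)).toAffine.Point, p • P = 0 → P = 0)
    (y : Kw p L w) :
    haveI := Literature.NumberTheory.EllipticCurves.EulerLattice.isIntegral_baseChange w.1 W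
    (∃ P : (W.baseChange (w.1.adicCompletion L)).toAffine.Point,
      Literature.NumberTheory.EllipticCurves.FormalGroupChart.padicLogPointFiniteExt
        (NormedField.valuation : Valuation (w.1.adicCompletion L) ℝ≥0)
        (W.baseChange (w.1.adicCompletion L)) p P = toCompletion p L w y) ↔
    ‖φ (φ y) - (W.frobeniusTrace p : Kw p L w) * φ y + (p : Kw p L w) * y‖ ≤ ‖(p : Kw p L w)‖ := by
  haveI : IsUltrametricDist (Kw p L w) := isUltrametricDist (p := p) (L := L) (w := w)
  have hK : ∀ x : Kw p L w, ‖x‖ < 1 → ‖x‖ ≤ ‖((p : ℕ) : Kw p L w)‖ :=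
    fun x hx => norm_le_norm_prime_of_norm_lt_one he.out x hx
  exact exists_padicLog_eq_iff_norm_eulerOperator_le p L w W hΔ φ (norm_algHom_eq φ) hφp
    (finrank_pos p L w) rfl (finrank_eq_inertiaDeg p L w he.out).symm
    (pow_finrank_apply_eq_of_frobeniusLift hK φ hφp) (eq_of_pow_eq_pow_of_frobeniusLift hK φ hφp) hT y

omit [W.IsElliptic] [W.IsGloballyMinimal] in
/-- **A Frobenius element at an unramified place has order exactly `f(w∣p)`**: for `σ ∈ Aut(L/ℚ)` with
`σ • w = w` and `σ a ≡ a^p (mod w)` on `𝓞 L`, `e(w∣p) = 1`: `ord σ = f(w∣p)` — the `hord` binder of acc3's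
`KimAtThreeKwFrobenius.exists_padicLog_eq_iff_of_frobenius` is a theorem (`σ_w` generates `Gal(K_w/ℚ_p)` of
order `[K_w : ℚ_p] = f(w∣p)`, and `σ ↦ σ_w` is faithful on `L ↪ L_w`). [cite: SerreLocalFields1979, Ch. I §8, Ch. III §5] -/
theorem orderOf_eq_inertiaDeg_of_frobenius [he : Fact (w.1.asIdeal.ramificationIdx (𝓞 ℚ) = 1)]
    (σ : L ≃ₐ[ℚ] L) (hσ : σ • w.1 = w.1) (hσp : ∀ a : 𝓞 L, σ • a - a ^ p ∈ w.1.asIdeal) :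
    orderOf σ = w.1.asIdeal.inertiaDeg (𝓞 ℚ) := by
  haveI : IsUltrametricDist (Kw p L w) := isUltrametricDist (p := p) (L := L) (w := w)
  haveI : Algebra.IsAlgebraic ℚ_[p] (Kw p L w) := Algebra.IsAlgebraic.of_finite ℚ_[p] (Kw p L w)
  have hK : ∀ x : Kw p L w, ‖x‖ < 1 → ‖x‖ ≤ ‖((p : ℕ) : Kw p L w)‖ :=
    fun x hx => norm_le_norm_prime_of_norm_lt_one he.out x hx
  obtain ⟨φ, hφ⟩ := exists_algHom_eq_galAdicCompletionMap (p := p) (L := L) (w := w) σ hσ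
  have hφp := norm_map_sub_pow_lt_one σ hσ φ hφ hσp
  have hbij := Algebra.IsAlgebraic.algHom_bijective φ
  have horde : orderOf (AlgEquiv.ofBijective φ hbij) = Module.finrank ℚ_[p] (Kw p L w) :=
    orderOf_eq_finrank_of_frobeniusLift hK (AlgEquiv.ofBijective φ hbij) (fun y hy => hφp y hy)
  rw [← finrank_eq_inertiaDeg p L w he.out, ← horde, orderOf_eq_orderOf_iff]
  intro n
  constructor
  · intro hn
    apply AlgEquiv.ext
    intro y
    rw [ofBijective_pow_apply, AlgEquiv.one_apply]
    exact pow_apply_eq_self σ hσ φ hφ hn y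
  · intro hn
    apply AlgEquiv.ext
    intro x
    have hx := AlgEquiv.congr_fun hn ((toCompletion p L w).symm (x : w.1.adicCompletion L))
    rw [ofBijective_pow_apply, AlgEquiv.one_apply] at hx
    have hx' := congrArg (toCompletion p L w) hx
    simp only [toCompletion_pow_apply σ hσ φ hφ, RingEquiv.apply_symm_apply, galAdicCompletionMap_coe,
      AlgEquiv.smul_def] at hx'
    rw [AlgEquiv.one_apply]
    exact (algebraMap L (w.1.adicCompletion L)).injective hx'

/-- **The lattice lemma from GLOBAL Frobenius data, without the order binder.** acc3's
`KimAtThreeKwFrobenius.exists_padicLog_eq_iff_of_frobenius` (p528906) with `hord : ord σ = f(w∣p)` DISCHARGED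
(`orderOf_eq_inertiaDeg_of_frobenius`): for `W/ℚ` globally minimal, `p ∤ Δ_min`, `e(w∣p) = 1`,
`σ ∈ Aut(L/ℚ)` with `σ • w = w` and `σ a ≡ a^p (mod w)`, `φ = σ_w` on `K_w`, and `E(L_w)[p] = 0`:
`(∃ P, log_ω P = y) ↔ ‖φφy − a_p·φy + p·y‖ ≤ ‖p‖`. [cite: BlochKato1990, Example 3.11] [cite: SilvermanAEC2009, Thm. IV.6.4 and V.2.3.1] -/
theorem exists_padicLog_eq_iff_of_frobenius' [he : Fact (w.1.asIdeal.ramificationIdx (𝓞 ℚ) = 1)]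
    (hΔ : ¬ (p : ℤ) ∣ WeierstrassCurve.minimalDiscriminantInt W)
    (σ : L ≃ₐ[ℚ] L) (hσ : σ • w.1 = w.1) (hσp : ∀ a : 𝓞 L, σ • a - a ^ p ∈ w.1.asIdeal)
    (φ : Kw p L w →ₐ[ℚ_[p]] Kw p L w)
    (hφ : ∀ y, toCompletion p L w (φ y) = galAdicCompletionMap σ hσ (toCompletion p L w y))
    (hT : ∀ P : (W.baseChange (w.1.adicCompletion L)).toAffine.Point, p • P = 0 → P = 0)
    (y : Kw p L w) :
    haveI := Literature.NumberTheory.EllipticCurves.EulerLattice.isIntegral_baseChange w.1 W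
    (∃ P : (W.baseChange (w.1.adicCompletion L)).toAffine.Point,
      Literature.NumberTheory.EllipticCurves.FormalGroupChart.padicLogPointFiniteExt
        (NormedField.valuation : Valuation (w.1.adicCompletion L) ℝ≥0)
        (W.baseChange (w.1.adicCompletion L)) p P = toCompletion p L w y) ↔
    ‖φ (φ y) - (W.frobeniusTrace p : Kw p L w) * φ y + (p : Kw p L w) * y‖ ≤ ‖(p : Kw p L w)‖ :=
  exists_padicLog_eq_iff_norm_eulerOperator_le_of_frobeniusLift W hΔ φ
    (norm_map_sub_pow_lt_one σ hσ φ hφ hσp) hT y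

end LatticeLemma

end Summit.BirchSwinnertonDyer.BirchSwinnertonDyer.Theorems.KPort.Kw

end
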